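import Summits.MatrixMultiplication.OmegaCensus.HeisenbergUniform
import Summits.MatrixMultiplication.OmegaCensus.BoxUsefulDihedral

/-!
# ω-census, family (b3): conjecture C9 on the HEISENBERG FAMILY — classification `BoxUseful (Heis p) ↔ p ≤ 2`

HONEST FRAMING (pub-omega census; verbatim): lottery ticket; floor = certified bounds/negative ranges.
Census BOOKKEEPING (conjecture C9 of the cell; pub-omega stpp-1 gen 19).  With `HeisenbergUniform` (every odd `p ≥ 3`) the whole
family `Heis p` (`(a,b,c)(a',b',c') = (a+a', b+b', c+c'+ab')` over `ZMod p`, order `p³`, centre index `p²` for `p ≥ 2`) is settled: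
* `reduce : Heis p →* Heis q` for `q ∣ p` (coordinatewise `ZMod.castHom`), surjective;
* `Heis 4` (order `64`, centre index `16`) is not box-useful: planar box `u = (0,0),(0,1),(1,0)`, `v = (0,0),(0,1),(1,1)` with an
  independent pattern of `8 = 2·4` heights (`decide`; exact optimum of its fibre graph), `5·8 ≥ 9·4`;
* every even `p ≥ 4` maps onto `Heis 4` (`4 ∣ p`) or onto `Heis (p/2)` with `p/2 ≥ 3` odd, so **`not_boxUseful_heis : 3 ≤ p →
  ¬ BoxUseful (Heis p)`** for EVERY `p ≥ 3`, with witness form `exists_indep_heis` and the lifts `…_of_surjective_heis'`,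
  `…_of_injective_heis'`;
* `exists_indep_nine_fourths`: for odd `p ≥ 11` the uniform pattern gives `#I ≥ (9/4 − 15/(2p))·p³` — box ratio `→ ≥ 9/4`;
* `Heis 1` is trivial and `Heis 2 ≅ D₈` has centre index `4` (box-useful by the class theorems), hence
  **`boxUseful_heis_iff : BoxUseful (Heis p) ↔ p ≤ 2`** — C9 (b) on the whole Heisenberg family: the useful members are exactly
  the abelian one and the centre-index-`4` one.
Nothing here is progress on `ω`.
-/

namespace Summit.MatrixMultiplication.OmegaCensus

open Finset ProductBoxBound

namespace Heis

variable {p q : ℕ}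

/-! ### Reduction maps -/

/-- Reduction `Heis p → Heis q` mod `q ∣ p`, coordinatewise. [folklore] -/
def reduce (h : q ∣ p) : Heis p →* Heis q where
  toFun x := ⟨ZMod.castHom h (ZMod q) x.a, ZMod.castHom h (ZMod q) x.b, ZMod.castHom h (ZMod q) x.c⟩
  map_one' := by apply Heis.ext <;> simp only [Heis.one_def, map_zero]
  map_mul' x y := by apply Heis.ext <;> simp only [Heis.mul_def, map_add, map_mul]

/-- Reduction is surjective. [folklore] -/
theorem reduce_surjective (h : q ∣ p) : Function.Surjective (reduce h) := by
  intro y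
  obtain ⟨a, ha⟩ := ZMod.ringHom_surjective (ZMod.castHom h (ZMod q)) y.a
  obtain ⟨b, hb⟩ := ZMod.ringHom_surjective (ZMod.castHom h (ZMod q)) y.b
  obtain ⟨c, hc⟩ := ZMod.ringHom_surjective (ZMod.castHom h (ZMod q)) y.c
  exact ⟨⟨a, b, c⟩, Heis.ext ha hb hc⟩

/-! ### `Heis 4` -/

/-- A planar box of `Heis 4`: `u = (0,0), (0,1), (1,0)`, `v = (0,0), (0,1), (1,1)`. [folklore] -/
def D4 : PlanarBox 4 := ⟨![0, 0, 1], ![0, 1, 0], ![0, 0, 1], ![0, 1, 1]⟩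

/-- An optimal pattern of `D4`: `8 = 2·4` heights. [folklore] -/
def T4 : Finset ((Fin 3 × Fin 3) × ZMod 4) :=
  {((0, 0), 1), ((0, 1), 0), ((0, 1), 3), ((1, 1), 2), ((1, 2), 3), ((2, 0), 2), ((2, 2), 0), ((2, 2), 3)}

/-- `D4` is nondegenerate. [folklore] -/
theorem nondeg_D4 : D4.Nondeg := ⟨by decide, by decide⟩

/-- `T4` is independent. [folklore] -/
theorem patIndep_T4 : D4.PatIndep T4 := by decide +kernel

/-- **`Heis 4` (order `64`, centre index `16`) is not box-useful** (`5·8·16 = 640 ≥ 576 = 9·64`). [folklore] -/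
theorem not_boxUseful_heis4 : ¬ BoxUseful (Heis 4) :=
  D4.not_boxUseful_of_pattern nondeg_D4 patIndep_T4 (by decide)

/-! ### Every `p ≥ 3` -/

/-- Lifting a witness along a surjection, in ratio form: a quotient witness with `9|Q| ≤ 5#I` gives one upstairs with
`9|G| ≤ 5#J`. [folklore] -/
theorem exists_indep_ge_of_surjective {G Q : Type*} [Group G] [Fintype G] [DecidableEq G] [Group Q] [Fintype Q]
    [DecidableEq Q] (f : G →* Q) (hf : Function.Surjective f)
    (h : ∃ (Y W : Finset Q) (I : Finset (Q × Q × Q)), #Y = 3 ∧ #W = 3 ∧ I ⊆ univ ×ˢ (Y ×ˢ W) ∧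
      (∀ P ∈ I, ∀ P' ∈ I, P ≠ P' → cellWord P P' ≠ 1) ∧ 9 * Fintype.card Q ≤ 5 * #I) :
    ∃ (Y W : Finset G) (J : Finset (G × G × G)), #Y = 3 ∧ #W = 3 ∧ J ⊆ univ ×ˢ (Y ×ˢ W) ∧
      (∀ P ∈ J, ∀ P' ∈ J, P ≠ P' → cellWord P P' ≠ 1) ∧ 9 * Fintype.card G ≤ 5 * #J := by
  obtain ⟨Y, W, I, hY, hW, hI, hind, hbig⟩ := h
  obtain ⟨Y', W', J, hY', hW', hJ, hJind, hJcard⟩ := exists_indep_of_surjective f hf hI hind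
  refine ⟨Y', W', J, hY'.trans hY, hW'.trans hW, hJ, hJind, ?_⟩
  have hQ : 0 < Fintype.card Q := Fintype.card_pos
  nlinarith [hJcard, hbig, hQ]

/-- **Witness form, every `p ≥ 3`**: a `3 × 3` box of `Heis p` with an independent cell set `I`, `9·|Heis p| ≤ 5·#I`. [folklore] -/
theorem exists_indep_heis [NeZero p] (h3 : 3 ≤ p) :
    ∃ (Y W : Finset (Heis p)) (I : Finset (Heis p × Heis p × Heis p)),
      #Y = 3 ∧ #W = 3 ∧ I ⊆ univ ×ˢ (Y ×ˢ W) ∧ (∀ P ∈ I, ∀ P' ∈ I, P ≠ P' → cellWord P P' ≠ 1) ∧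
        9 * Fintype.card (Heis p) ≤ 5 * #I := by
  rcases Nat.even_or_odd p with he | ho
  · by_cases h4 : 4 ∣ p
    · refine exists_indep_ge_of_surjective (reduce h4) (reduce_surjective h4) ?_
      obtain ⟨Y, W, I, hY, hW, hI, hind, hcard⟩ := D4.exists_indep_of_pattern nondeg_D4 patIndep_T4
      exact ⟨Y, W, I, hY, hW, hI, hind, by rw [hcard, Heis.card]; decide⟩
    · obtain ⟨d, rfl⟩ := he
      rcases Nat.even_or_odd d with ⟨e, rfl⟩ | hd
      · exact absurd ⟨e, by ring⟩ h4
      · haveI : NeZero d := ⟨by omega⟩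
        exact exists_indep_ge_of_surjective (reduce (⟨2, by ring⟩ : d ∣ d + d)) (reduce_surjective _)
          (exists_indep_odd hd (by omega))
  · exact exists_indep_odd ho h3

/-- **MAIN.  `Heis p` is not box-useful for every `p ≥ 3`.** [folklore] -/
theorem not_boxUseful_heis [NeZero p] (h3 : 3 ≤ p) : ¬ BoxUseful (Heis p) := by
  obtain ⟨Y, W, I, hY, hW, hI, hind, hbig⟩ := exists_indep_heis h3
  exact not_boxUseful_of_indep hY hW hI hind hbig

/-- **No finite group mapping onto some `Heis p`, `p ≥ 3`, is box-useful.** [folklore] -/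
theorem not_boxUseful_of_surjective_heis' [NeZero p] (h3 : 3 ≤ p) {G : Type*} [Group G] [Fintype G] [DecidableEq G]
    (f : G →* Heis p) (hf : Function.Surjective f) : ¬ BoxUseful G := by
  obtain ⟨Y, W, I, hY, hW, hI, hind, hbig⟩ := exists_indep_heis h3
  exact not_boxUseful_of_surjective f hf hY hW hI hind hbig

/-- **No finite group containing some `Heis p`, `p ≥ 3`, is box-useful.** [folklore] -/
theorem not_boxUseful_of_injective_heis' [NeZero p] (h3 : 3 ≤ p) {G : Type*} [Group G] [Fintype G] [DecidableEq G]
    (f : Heis p →* G) (hf : Function.Injective f) : ¬ BoxUseful G := by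
  obtain ⟨Y, W, I, hY, hW, hI, hind, hbig⟩ := exists_indep_heis h3
  exact not_boxUseful_of_injective f hf hY hW hI hind hbig

/-! ### The asymptotic ratio `9/4` -/

/-- The uniform pattern has at least `(9p − 30)/4` heights per `(a,b)`-class for odd `p ≥ 11` (`#Tunif = 6r − 3`,
`r = ⌊(3p+1)/8⌋ ≥ (3p − 6)/8`). [folklore] -/
theorem card_Tunif_ge (hp : p % 2 = 1) (h11 : 11 ≤ p) : 9 * p ≤ 4 * #(Tunif p) + 30 := by
  rw [card_Tunif (by omega)]
  simp only [Fin.sum_univ_three, lenN, hA, rr, Matrix.cons_val_zero, Matrix.cons_val_one, Matrix.cons_val_two,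
    Matrix.head_cons, Matrix.tail_cons]
  rcases (by omega : p % 8 = 1 ∨ p % 8 = 3 ∨ p % 8 = 5 ∨ p % 8 = 7) with h8 | h8 | h8 | h8 <;> omega

/-- **The box ratio of `Heis p` is asymptotically at least `9/4`** (the value of `A₄`): for odd `p ≥ 11` a `3 × 3` box of
`Heis p` carries an independent cell set `I` with `9·|Heis p| ≤ 4·#I + 30p²`, i.e. `#I ≥ (9/4 − 15/(2p))·p³`. [folklore] -/
theorem exists_indep_nine_fourths [NeZero p] (hp : Odd p) (h11 : 11 ≤ p) :
    ∃ (Y W : Finset (Heis p)) (I : Finset (Heis p × Heis p × Heis p)),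
      #Y = 3 ∧ #W = 3 ∧ I ⊆ univ ×ˢ (Y ×ˢ W) ∧ (∀ P ∈ I, ∀ P' ∈ I, P ≠ P' → cellWord P P' ≠ 1) ∧
        9 * Fintype.card (Heis p) ≤ 4 * #I + 30 * (p * p) := by
  have hp' := Nat.odd_iff.1 hp
  obtain ⟨Y, W, I, hY, hW, hI, hind, hcard⟩ :=
    (Dunif p).exists_indep_of_pattern (nondeg_Dunif hp' (by omega)) (patIndep_Tunif hp' (by omega))
  refine ⟨Y, W, I, hY, hW, hI, hind, ?_⟩
  have hge := card_Tunif_ge hp' h11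
  rw [hcard, Heis.card]
  calc 9 * (p * (p * p)) = (9 * p) * (p * p) := by ring
    _ ≤ (4 * #(Tunif p) + 30) * (p * p) := Nat.mul_le_mul_right _ hge
    _ = 4 * (#(Tunif p) * (p * p)) + 30 * (p * p) := by ring

/-! ### `Heis 1`, `Heis 2`, and the classification -/

/-- `Heis 1` (trivial) is box-useful. [folklore] -/
theorem boxUseful_heis_one : BoxUseful (Heis 1) :=
  BoxUseful.of_index_center_one (center_index_one_of_comm (by decide))

/-- `Heis 2 ≅ D₈`: centre `{1, ⟨0,0,1⟩}` of index `4`, box-useful. [folklore] -/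
theorem boxUseful_heis_two : BoxUseful (Heis 2) := by
  apply BoxUseful.of_index_center_four
  apply center_index_of_card (c := 2) _ (by simp [Nat.card_eq_fintype_card, Heis.card]) (by norm_num)
  rw [Nat.card_eq_fintype_card]; decide

/-- **CLASSIFICATION.  `Heis p` is box-useful iff `p ≤ 2`** (`p ≥ 1`): C9 (b) on the whole Heisenberg family — the useful
members are exactly the abelian `Heis 1` and the centre-index-`4` group `Heis 2 ≅ D₈`. [folklore] -/
theorem boxUseful_heis_iff [NeZero p] : BoxUseful (Heis p) ↔ p ≤ 2 := by
  constructor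
  · intro h
    by_contra hp
    exact not_boxUseful_heis (by omega) h
  · intro hp
    obtain rfl | rfl : p = 1 ∨ p = 2 := by have := NeZero.ne p; omega
    · exact boxUseful_heis_one
    · exact boxUseful_heis_two

end Heis

end Summit.MatrixMultiplication.OmegaCensus
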